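import Summits.HodgeConjecture.HodgeConjecture.Theorems.Ring2AbelianAllCMJunction
import Summits.HodgeConjecture.HodgeConjecture.Theorems.Ring2AbelianAllFrameCrossBranch
import HarnessLib

/-!
# Ring 2 · §AbelianAll (seat `ab-andre-1`), III — the CM-anchored junction in the LEAD's FRAME: `HC_AV` from each
# CM-localised node ALONE, exactness `HC_AV ↔ (4)` WITHOUT `HC_CM`, and the `CMIdle` column for (4), (L), (3),
# R_{6.3.1}, (5) — all modulo the displayed junction `JunctionCM` (part II) and Lemme 6.3.1

HONEST FRAMING: research route, not a corollary; conditional on HC_CM plus one named minimal statement.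
(Cell line: research route conditional on HC_CM; not a corollary; Q11.4-sentence-2 already refuted in dim ≥ 3.)

Cell `pub-hodge-ring2`, sub-cell `pub-hodge-ring2-ab-*` (ALL ABELIAN VARIETIES), seat `ab-andre-1`, gen 2, companion of
part II `Ring2AbelianAllCMJunction` (the junctions `JunctionCM ⇐ JunctionCMPower ⇐ JunctionEllipticPowers` and the
rows `B ∧ JunctionCM ⊢ HC_CM`). `HC_CM` = `Theses.RankFourFaces.CMAbelianHodge` (stmt-3052) is a CONCLUSION or an
eliminated conjunct here, never a fact; `HC_AV` = `Theses.PadicSemiregularLift.HodgeAbelianVarieties` (stmt-1333);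
`Theses.RankFourFaces.CMToAbelian` (stmt-16267) is OPEN and NOT closed here (one typed conditional toward it, §G).
Nothing here proves a case of the Hodge conjecture; `JunctionCM` (print's Lemmes 6.3.2–6.3.3 + ONE displayed
inference, part II) and Lemme 6.3.1 (`h₂₁ = andre1996_cmAnchoredPencil`, the literature seat's cited fact #21) are
HYPOTHESES of every row; no statement minted in this cell is cited as a fact.

## Rows (kernel; `hJ : JunctionCM`, `h₂₁` = Lemme 6.3.1, `h₈` = Abdulali p. 1122)

| node `B` | `B ∧ hJ ∧ h₂₁ ⊢ HC_AV`, i.e. `Frame.CMIdle B` | `hJ ∧ h₂₁ ⊢ HC_AV ↔ B` |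
|---|---|---|
| (4) `CMFibreTransport` ≡ `CMAnchoredTransport` | `HC_AV_of_andre1996_of_junctionCM_of_cmFibreTransport`, `cmIdle_cmFibreTransport_…`, `cmIdle_cmAnchoredTransport_…` | `HC_AV_iff_cmFibreTransport_of_andre1996_of_junctionCM`, `HC_AV_iff_cmLocalised_…` |
| (L) `CMFibreAlgebraicLift` | `HC_AV_of_andre1996_of_junctionCM_of_cmFibreAlgebraicLift`, `cmIdle_cmFibreAlgebraicLift_…` | — ((L) has no on-path lemma: cycle-theoretic, strictly finer as typed) |
| (3) `CMPointedPencilVHC`, deform's `CMPointedCompactPencilVHC`, R_{6.3.1} `CMAnchoredPencilVHC` | `cmIdle_cmPointedPencilVHC_…`, `cmIdle_deformCMLocalised_…` | `HC_AV_iff_cmLocalised_…` ((3)); deform VI (R_{6.3.1}) |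
| (5) `CMPointedPencilLefschetz` ≡ `LefschetzBCMPointedPencils` (mod `h₈`) | `HC_AV_of_abdulali_of_andre1996_of_junctionCM_of_cmPointedPencilLefschetz`, `cmIdle_cmPointedPencilLefschetz_…`, `cmIdle_lefschetzBCMPointedPencils_…` | not claimed (`B` of a total space ⇍ `HC_AV`; Tankeev's converse claims unverified, acq-01874) |

READING (REFEREE-AB F-ab-4 / AB.F3 R1 respected — no "minimality" is asserted or moved): the LEAD's Frame table
(`Ring2AbelianAllFrame` §2) had `CMIdle` for (4) "not in kernel; in PRINT yes" and for (L) "not known"; both are now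
kernel rows MODULO the displayed junction `JunctionCM` and `h₂₁` — the same status deform VI gave (3) and R_{6.3.1}
modulo its inline `J₂₂⁺` (which `JunctionCM` implies, part II `junctionPlus_of_junctionCM`). Consequently, granted
`hJ` and `h₂₁`, the sub-cell's deliverable `HC_AV_of_HC_CM_and_Bmin : HC_CM → B → HC_AV` has a DECORATIVE first
hypothesis for EVERY CM-localised `B` of KIND 1 ((2), (3), R_{6.3.1}, (4), (L), (5), (5∀), (L∀)):
`(HC_CM ∧ (4)) ↔ (4)` (`HC_CM_and_cmFibreTransport_iff_of_junctionCM`). The nodes for which `HC_CM` is NOT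
decorative in print or kernel are the KIND-2 ones — (T∃) `CMAnchoredPencilTransport`, CPS_CM / CPS_∃
(deform XIII), U / U_Z (andre-2 VI–VII) — untouched here.

Rev. 2 (§H, LEAD Frame III `Ring2AbelianAllFrameCrossBranch`, p196810): granted `hJ` and `h₂₁` the CM-localised COMPLEMENTS
(3), (3 deform), R_{6.3.1}, (4), (4′) are PIVOTS — `PivotAV B := CMIdle B ∧ OnPathAV B` instances by name
(`pivotAV_cmLocalised_of_andre1996_of_junctionCM`), hence pairwise equivalent and equivalent to the pencil-top
pivots (2)/(1) by `iff_of_pivotAV`, with NO `HC_CM`; in the LEAD's kernel KIND predicate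
`cmIdle_iff_closesWithCM_and_imp_HC_CM` the conjunct `B → HC_CM` is part II's row and `ClosesWithCM B` is abI/abIII's.
(L) and (5) get `CMIdle` but no `OnPathAV` (none is claimed for them), so they are NOT asserted pivots.

References: Andre1996Motifs (Lemme 6.3.1 p. 31; Lemmes 6.3.2–6.3.3 pp. 32–33; Remarque 2 p. 33),
Abdulali1994FamiliesAV (pp. 1122–1123, Lemma 6.2 p. 1131), Milne2020HodgeClassesAV (Rem. 2–3),
CharlesSchnell2014Notes (Cor. 11.3.6 p. 494).
-/

noncomputable section

-- the summit's module path `Summit.HodgeConjecture.HodgeConjecture.…` repeats a component (sub = summit), which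
-- the `dupNamespace` linter flags on every declaration; all Ring-2 files of the cell disable it for this reason.
set_option linter.dupNamespace false

namespace Summit.HodgeConjecture.HodgeConjecture.Ring2.AbelianAll

open CategoryTheory AlgebraicGeometry
open Literature.AlgebraicGeometry Literature.AlgebraicGeometry.Motives
open Literature.AlgebraicGeometry.HodgeTheory
open Literature.AlgebraicGeometry.Abdulali1994 (Abdulali1994_invariantCycles_of_lefschetzStandard)
open Literature.AlgebraicGeometry.Andre1996 (andre1996_cmAnchoredPencil
  andre1996_cmHodgeClasses_algebraicallyAnchoredPencils)
open Summit.HodgeConjecture.HodgeConjecture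
open Summit.HodgeConjecture.HodgeConjecture.Theses
open Summit.HodgeConjecture.HodgeConjecture.Ring2.Deform (CMPointedCompactPencilVHC CMAnchoredPencilVHC)

/-- The headline row in the two stronger readings: `J^{CM,pow} ∧ (4) ⟹ HC_CM` and `J^{∀E} ∧ (4) ⟹ HC_CM`.
[cite: Andre1996Motifs, Lemme 6.3.3 (ii) and proof (p. 33)] -/
theorem HC_CM_of_junctionEllipticPowers_of_cmFibreTransport :
    (JunctionCMPower → CMFibreTransport → RankFourFaces.CMAbelianHodge) ∧
      (JunctionEllipticPowers → CMFibreTransport → RankFourFaces.CMAbelianHodge) :=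
  ⟨fun hJ ↦ HC_CM_of_junctionCM_of_cmFibreTransport (junctionCM_of_junctionCMPower hJ),
    fun hJ ↦ HC_CM_of_junctionCM_of_cmFibreTransport (junctionCM_of_junctionEllipticPowers hJ)⟩

/-! ## §F `HC_AV` from the node ALONE, exactness WITHOUT `HC_CM`, and what `HC_CM` is worth next to (4) -/

/-- **`HC_AV` from (4) ALONE, granted Lemme 6.3.1 and `J^{CM}`** (`HC_CM` an intermediate conclusion, as in deform
IV (M′) for (2)): abIII `HC_AV_of_HC_CM_and_cmFibreTransport` with its `hCM` PRODUCED by §E.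
[cite: Andre1996Motifs, §6.3 (pp. 31–33)] [cite: Milne2020HodgeClassesAV, Rem. 2–3] -/
theorem HC_AV_of_andre1996_of_junctionCM_of_cmFibreTransport (h₂₁ : andre1996_cmAnchoredPencil)
    (hJ : JunctionCM) (hT : CMFibreTransport) : PadicSemiregularLift.HodgeAbelianVarieties :=
  HC_AV_of_HC_CM_and_cmFibreTransport h₂₁ (HC_CM_of_junctionCM_of_cmFibreTransport hJ hT) hT

/-- **EXACTNESS WITHOUT `HC_CM`: granted Lemme 6.3.1 and `J^{CM}`, `HC_AV ↔ (4)`** — the directional node is `HC_AV`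
in disguise, exactly as (2) (deform IV (E₂′)) and (3), R_{6.3.1} (deform VI).
[cite: Andre1996Motifs, §6.3 Remarque 2 (p. 33)] [cite: CharlesSchnell2014Notes, Cor. 11.3.6 (p. 494)] -/
theorem HC_AV_iff_cmFibreTransport_of_andre1996_of_junctionCM (h₂₁ : andre1996_cmAnchoredPencil)
    (hJ : JunctionCM) : PadicSemiregularLift.HodgeAbelianVarieties ↔ CMFibreTransport :=
  ⟨cmFibreTransport_of_HC_AV, HC_AV_of_andre1996_of_junctionCM_of_cmFibreTransport h₂₁ hJ⟩

/-- The same for andre-2's spelling (4) `CMAnchoredTransport` and for (3).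
[cite: Andre1996Motifs, §6.3 Remarque 2 (p. 33)] -/
theorem HC_AV_iff_cmLocalised_of_andre1996_of_junctionCM (h₂₁ : andre1996_cmAnchoredPencil) (hJ : JunctionCM) :
    (PadicSemiregularLift.HodgeAbelianVarieties ↔ CMAnchoredTransport) ∧
      (PadicSemiregularLift.HodgeAbelianVarieties ↔ CMPointedPencilVHC) :=
  ⟨⟨cmAnchoredTransport_of_HC_AV, fun hT ↦ HC_AV_of_andre1996_of_junctionCM_of_cmFibreTransport h₂₁ hJ
      (cmAnchoredTransport_iff_cmFibreTransport.1 hT)⟩,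
    ⟨cmPointedPencilVHC_of_HC_AV, fun hV ↦ HC_AV_of_andre1996_of_junctionCM_of_cmFibreTransport h₂₁ hJ
      (cmAnchoredTransport_iff_cmFibreTransport.1 (cmAnchoredTransport_of_cmPointedPencilVHC hV))⟩⟩

/-- **What `HC_CM` is worth next to (4): nothing**, granted `J^{CM}`: `(HC_CM ∧ (4)) ↔ (4)` (deform IV (E₃′) for the
directional node). [cite: Andre1996Motifs, §6.3 Remarque 2 (p. 33)] -/
theorem HC_CM_and_cmFibreTransport_iff_of_junctionCM (hJ : JunctionCM) :
    (RankFourFaces.CMAbelianHodge ∧ CMFibreTransport) ↔ CMFibreTransport :=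
  ⟨And.right, fun hT ↦ ⟨HC_CM_of_junctionCM_of_cmFibreTransport hJ hT, hT⟩⟩

/-- `HC_AV` from (L) alone, granted Lemme 6.3.1 and `J^{CM}`. [cite: Andre1996Motifs, §5.1 and §6.3 (pp. 25, 31–33)] -/
theorem HC_AV_of_andre1996_of_junctionCM_of_cmFibreAlgebraicLift (h₂₁ : andre1996_cmAnchoredPencil)
    (hJ : JunctionCM) (hL : CMFibreAlgebraicLift) : PadicSemiregularLift.HodgeAbelianVarieties :=
  HC_AV_of_HC_CM_and_cmFibreAlgebraicLift h₂₁ (HC_CM_of_junctionCM_of_cmFibreAlgebraicLift hJ hL) hL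

/-- `HC_AV` from (5) alone, granted `h₈`, Lemme 6.3.1 and `J^{CM}` (part I's KIND-2-as-typed row
`HC_AV_of_abdulali_of_andre1996_of_HC_CM_of_cmPointedPencilLefschetz` with its `hCM` produced by §E).
[cite: Abdulali1994FamiliesAV, pp. 1122–1123] [cite: Andre1996Motifs, Lemme 6.3.1 and Remarque 2 (pp. 31–33)] -/
theorem HC_AV_of_abdulali_of_andre1996_of_junctionCM_of_cmPointedPencilLefschetz
    (h₈ : Abdulali1994_invariantCycles_of_lefschetzStandard) (h₂₁ : andre1996_cmAnchoredPencil)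
    (hJ : JunctionCM) (hB : CMPointedPencilLefschetz) : PadicSemiregularLift.HodgeAbelianVarieties :=
  HC_AV_of_abdulali_of_andre1996_of_HC_CM_of_cmPointedPencilLefschetz h₈ h₂₁
    (HC_CM_of_abdulali_of_junctionCM_of_cmPointedPencilLefschetz h₈ hJ hB) hB

/-! ## §G The Frame grammar (LEAD, `Ring2AbelianAllFrame`): the `CMIdle` column for the CM-localised nodes -/

/-- **Frame row (4): `CMIdle CMFibreTransport`** modulo Lemme 6.3.1 and `J^{CM}` (the LEAD's table entry "(4):
CMIdle not in kernel; in PRINT yes" made kernel modulo the displayed junction). [cite: Andre1996Motifs, §6.3 (pp. 31–33)] -/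
theorem cmIdle_cmFibreTransport_of_andre1996_of_junctionCM (h₂₁ : andre1996_cmAnchoredPencil)
    (hJ : JunctionCM) : CMIdle CMFibreTransport :=
  fun hT ↦ HC_AV_of_andre1996_of_junctionCM_of_cmFibreTransport h₂₁ hJ hT

/-- Frame row (4), andre-2's spelling: `CMIdle CMAnchoredTransport` mod `h₂₁`, `J^{CM}`. [folklore] -/
theorem cmIdle_cmAnchoredTransport_of_andre1996_of_junctionCM (h₂₁ : andre1996_cmAnchoredPencil)
    (hJ : JunctionCM) : CMIdle CMAnchoredTransport :=
  cmIdle_antitone cmAnchoredTransport_iff_cmFibreTransport.1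
    (cmIdle_cmFibreTransport_of_andre1996_of_junctionCM h₂₁ hJ)

/-- **Frame row (L): `CMIdle CMFibreAlgebraicLift`** mod `h₂₁`, `J^{CM}` (the table entry "(L): CMIdle not known").
[cite: Andre1996Motifs, §5.1 (p. 25) and §6.3 (pp. 31–33)] -/
theorem cmIdle_cmFibreAlgebraicLift_of_andre1996_of_junctionCM (h₂₁ : andre1996_cmAnchoredPencil)
    (hJ : JunctionCM) : CMIdle CMFibreAlgebraicLift :=
  cmIdle_antitone cmAnchoredTransport_of_cmFibreAlgebraicLift
    (cmIdle_cmAnchoredTransport_of_andre1996_of_junctionCM h₂₁ hJ)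

/-- Frame row (3): `CMIdle CMPointedPencilVHC` mod `h₂₁`, `J^{CM}` (Frame §2 had it "only mod deform VI's `J₂₂⁺`,
local notation there; not restated" — now by name). [cite: Andre1996Motifs, §6.3 (pp. 31–33)] -/
theorem cmIdle_cmPointedPencilVHC_of_andre1996_of_junctionCM (h₂₁ : andre1996_cmAnchoredPencil)
    (hJ : JunctionCM) : CMIdle CMPointedPencilVHC :=
  cmIdle_antitone cmAnchoredTransport_of_cmPointedPencilVHC
    (cmIdle_cmAnchoredTransport_of_andre1996_of_junctionCM h₂₁ hJ)

/-- Frame rows for deform VI's twins (3) `CMPointedCompactPencilVHC` and R_{6.3.1} `CMAnchoredPencilVHC`, mod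
`h₂₁`, `J^{CM}`. [cite: Andre1996Motifs, §6.3 (pp. 31–33)] -/
theorem cmIdle_deformCMLocalised_of_andre1996_of_junctionCM (h₂₁ : andre1996_cmAnchoredPencil)
    (hJ : JunctionCM) : CMIdle CMPointedCompactPencilVHC ∧ CMIdle CMAnchoredPencilVHC :=
  ⟨fun hV ↦ Deform.HC_AV_of_andre1996_of_junction_of_cmAnchoredPencilVHC h₂₁ (junctionPlus_of_junctionCM hJ)
      (Deform.cmAnchoredPencilVHC_of_cmPointedCompactPencilVHC hV),
    fun hR ↦ Deform.HC_AV_of_andre1996_of_junction_of_cmAnchoredPencilVHC h₂₁ (junctionPlus_of_junctionCM hJ) hR⟩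

/-- **Frame row (5): `CMIdle CMPointedPencilLefschetz`** mod `h₈`, `h₂₁`, `J^{CM}` — the `B`-flavoured candidate
"HC_CM + ONE exact instance of Lefschetz `B`" of part I is, granted the junction, `HC_CM`-idle too (abIII had
`CMIdle` only for (5∀)). [cite: Abdulali1994FamiliesAV, pp. 1122–1123] [cite: Andre1996Motifs, Remarque 2 (p. 33)] -/
theorem cmIdle_cmPointedPencilLefschetz_of_abdulali_of_andre1996_of_junctionCM
    (h₈ : Abdulali1994_invariantCycles_of_lefschetzStandard) (h₂₁ : andre1996_cmAnchoredPencil)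
    (hJ : JunctionCM) : CMIdle CMPointedPencilLefschetz :=
  fun hB ↦ HC_AV_of_abdulali_of_andre1996_of_junctionCM_of_cmPointedPencilLefschetz h₈ h₂₁ hJ hB

/-- The same for andre-2's spelling (5) `LefschetzBCMPointedPencils` (abIII `lefschetzBCMPointedPencils_iff_…`).
[folklore] -/
theorem cmIdle_lefschetzBCMPointedPencils_of_abdulali_of_andre1996_of_junctionCM
    (h₈ : Abdulali1994_invariantCycles_of_lefschetzStandard) (h₂₁ : andre1996_cmAnchoredPencil)
    (hJ : JunctionCM) : CMIdle LefschetzBCMPointedPencils :=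
  cmIdle_antitone lefschetzBCMPointedPencils_iff_cmPointedPencilLefschetz.1
    (cmIdle_cmPointedPencilLefschetz_of_abdulali_of_andre1996_of_junctionCM h₈ h₂₁ hJ)

/-- **Under `J^{CM}` and Lemme 6.3.1 the CM-localised candidates (2), (3), (4) COINCIDE with `HC_AV` pairwise,
WITHOUT `HC_CM`** (abI `candidates_iff_of_HC_CM` needed `HC_CM`; here the junction produces it).
[cite: Andre1996Motifs, Remarque 2 (p. 33)] -/
theorem candidates_iff_of_andre1996_of_junctionCM (h₂₁ : andre1996_cmAnchoredPencil) (hJ : JunctionCM) :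
    (Deform.CompactAbelianPencilVHC ↔ CMFibreTransport) ∧ (CMPointedPencilVHC ↔ CMFibreTransport) ∧
      (CMAnchoredTransport ↔ CMFibreTransport) :=
  ⟨⟨cmFibreTransport_of_compactAbelianPencilVHC, fun hT ↦ Deform.compactAbelianPencilVHC_of_HC_AV
      (HC_AV_of_andre1996_of_junctionCM_of_cmFibreTransport h₂₁ hJ hT)⟩,
    ⟨fun hV ↦ cmAnchoredTransport_iff_cmFibreTransport.1 (cmAnchoredTransport_of_cmPointedPencilVHC hV),
      fun hT ↦ cmPointedPencilVHC_of_HC_AV (HC_AV_of_andre1996_of_junctionCM_of_cmFibreTransport h₂₁ hJ hT)⟩,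
    cmAnchoredTransport_iff_cmFibreTransport⟩

/-- The item from the node alone: granted Lemme 6.3.1 and `J^{CM}`, `(4) ⟹ CMToAbelian` (a typed conditional
TOWARD the open item stmt-16267; nothing closes it). [cite: Andre1996Motifs, Lemme 6.3.1 (p. 31)] -/
theorem cmToAbelian_of_andre1996_of_junctionCM_of_cmFibreTransport (h₂₁ : andre1996_cmAnchoredPencil)
    (hJ : JunctionCM) (hT : CMFibreTransport) : RankFourFaces.CMToAbelian :=
  cmToAbelian_of_closesWithCM
    (closesWithCM_of_cmIdle (cmIdle_cmFibreTransport_of_andre1996_of_junctionCM h₂₁ hJ)) hT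

/-! ## §H (rev. 2) The LEAD's Frame III tiers, granted `J^{CM}`: the CM-localised complements are PIVOTS -/

/-- **Granted `J^{CM}` and Lemme 6.3.1, the CM-localised COMPLEMENTS are PIVOTS** (`PivotAV B := CMIdle B ∧ OnPathAV B`,
Frame III): (4) `CMFibreTransport`, (4′) `CMAnchoredTransport`, (3) `CMPointedPencilVHC`, deform's (3)
`CMPointedCompactPencilVHC` and R_{6.3.1} `CMAnchoredPencilVHC` — `CMIdle` from §G, `OnPathAV` from part I / abI /
deform VI by name. [cite: Andre1996Motifs, Lemme 6.3.1 and Remarque 2 (pp. 31–33)] -/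
theorem pivotAV_cmLocalised_of_andre1996_of_junctionCM (h₂₁ : andre1996_cmAnchoredPencil) (hJ : JunctionCM) :
    PivotAV CMFibreTransport ∧ PivotAV CMAnchoredTransport ∧ PivotAV CMPointedPencilVHC ∧
      PivotAV CMPointedCompactPencilVHC ∧ PivotAV CMAnchoredPencilVHC :=
  have hd := cmIdle_deformCMLocalised_of_andre1996_of_junctionCM h₂₁ hJ
  ⟨⟨cmIdle_cmFibreTransport_of_andre1996_of_junctionCM h₂₁ hJ, cmFibreTransport_of_HC_AV⟩,
    ⟨cmIdle_cmAnchoredTransport_of_andre1996_of_junctionCM h₂₁ hJ, cmAnchoredTransport_of_HC_AV⟩,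
    ⟨cmIdle_cmPointedPencilVHC_of_andre1996_of_junctionCM h₂₁ hJ, cmPointedPencilVHC_of_HC_AV⟩,
    ⟨hd.1, Deform.cmPointedCompactPencilVHC_of_HC_AV⟩, ⟨hd.2, Deform.cmAnchoredPencilVHC_of_HC_AV⟩⟩

/-- **Cross-branch, no `HC_CM`: granted `J^{CM}`, `h₂₁`, `h₂₂`, the directional node (4) is EQUIVALENT to the
pencil-top pivots (2) `CompactAbelianPencilVHC` and (1) `AbelianSchemeVHC`** (Frame III `iff_of_pivotAV` with
`pivotAV_pencilTop_of_andre1996`; (2) ↔ (4) is also §G `candidates_iff_…` without `h₂₂`).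
[cite: Andre1996Motifs, §6.3 Remarque 2 (p. 33)] -/
theorem cmFibreTransport_iff_pencilTop_of_andre1996_of_junctionCM (h₂₁ : andre1996_cmAnchoredPencil)
    (h₂₂ : andre1996_cmHodgeClasses_algebraicallyAnchoredPencils) (hJ : JunctionCM) :
    (CMFibreTransport ↔ Deform.CompactAbelianPencilVHC) ∧ (CMFibreTransport ↔ Hypotheses.AbelianSchemeVHC) :=
  have hP := pivotAV_pencilTop_of_andre1996 h₂₁ h₂₂
  have h4 := (pivotAV_cmLocalised_of_andre1996_of_junctionCM h₂₁ hJ).1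
  ⟨iff_of_pivotAV h4 hP.2, iff_of_pivotAV h4 hP.1⟩

/-- `h₂₂` is itself a consequence of `J^{CM}` (part II `andre1996_fact22_of_junctionCM`), so the previous row
needs only `h₂₁` and `hJ`. [cite: Andre1996Motifs, Lemmes 6.3.2–6.3.3 (pp. 32–33)] -/
theorem cmFibreTransport_iff_pencilTop_of_andre1996_of_junctionCM' (h₂₁ : andre1996_cmAnchoredPencil)
    (hJ : JunctionCM) :
    (CMFibreTransport ↔ Deform.CompactAbelianPencilVHC) ∧ (CMFibreTransport ↔ Hypotheses.AbelianSchemeVHC) :=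
  cmFibreTransport_iff_pencilTop_of_andre1996_of_junctionCM h₂₁ (andre1996_fact22_of_junctionCM hJ) hJ

/-- **The LEAD's kernel KIND predicate, instantiated**: for (4), `CMIdle` (mod `h₂₁`, `hJ`) splits as
`ClosesWithCM (4)` (abIII, needs only `h₂₁`) AND `(4) → HC_CM` (part II, needs only `hJ`).
[cite: Andre1996Motifs, §6.3 (pp. 31–33)] -/
theorem kind_cmFibreTransport_of_andre1996_of_junctionCM (h₂₁ : andre1996_cmAnchoredPencil) (hJ : JunctionCM) :
    ClosesWithCM CMFibreTransport ∧ (CMFibreTransport → RankFourFaces.CMAbelianHodge) :=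
  ⟨fun hCM hT ↦ HC_AV_of_HC_CM_and_cmFibreTransport h₂₁ hCM hT, HC_CM_of_junctionCM_of_cmFibreTransport hJ⟩

/-- (L) and (5): `CMIdle` holds (§G) hence `ClosesWithCM ∧ (· → HC_CM)` by the LEAD's predicate — but NO `OnPathAV`
is claimed, so they are not asserted pivots. [cite: Andre1996Motifs, §5.1 and §6.3 (pp. 25, 31–33)]
[cite: Abdulali1994FamiliesAV, pp. 1122–1123] -/
theorem kind_cmFibreAlgebraicLift_and_cmPointedPencilLefschetz_of_junctionCM
    (h₈ : Abdulali1994_invariantCycles_of_lefschetzStandard) (h₂₁ : andre1996_cmAnchoredPencil) (hJ : JunctionCM) :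
    (ClosesWithCM CMFibreAlgebraicLift ∧ (CMFibreAlgebraicLift → RankFourFaces.CMAbelianHodge)) ∧
      (ClosesWithCM CMPointedPencilLefschetz ∧ (CMPointedPencilLefschetz → RankFourFaces.CMAbelianHodge)) :=
  ⟨cmIdle_iff_closesWithCM_and_imp_HC_CM.1 (cmIdle_cmFibreAlgebraicLift_of_andre1996_of_junctionCM h₂₁ hJ),
    cmIdle_iff_closesWithCM_and_imp_HC_CM.1
      (cmIdle_cmPointedPencilLefschetz_of_abdulali_of_andre1996_of_junctionCM h₈ h₂₁ hJ)⟩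

end Summit.HodgeConjecture.HodgeConjecture.Ring2.AbelianAll

end
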